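import Summits.QuantumFields.YangMills.Theorems.SwapVirialDeficitSwapRingSectorPairing
import Summits.QuantumFields.YangMills.Theorems.SwapVirialDeficitSwapRingSectorTriage
import Summits.QuantumFields.YangMills.Theorems.SwapVirialDeficitTauberSandwichRpow
import Mathlib.Analysis.SpecialFunctions.Pow.Asymptotics
import HarnessLib

/-!
# The σ-glued ring at fixed `L`: the SHARP-σ RUNG modulo ONE sector law
# (glue (D) for the BC5 rung `stub_rung_fixedL` of LINE «sharp-sigma» on ⟨stmt-QuantumFields-24197⟩ `SwapVirialDeficit.SwapGluedStiffness`;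
# LEAD ym-line-sfw-p2 g93's 07:46Z ruling; interface posted 07:51Z in fcl-p3 g43's ✓`tauber_sandwich_rpow` hypothesis shape; free-hands support of ⟨24197⟩)

★★★ `swap_rung_fixedL_of_principalLaw` — IF the principal σ-sector deficit `F^S_{000}` has a SHARP state density at fixed `L`,
`|μ_L{F^S_{000} ≤ t}/(v·t^N) − 1| ≤ κ·t^θ` on `(0, t₀]` with `N = 9L⁴ − 1` (VERBATIM the hypothesis `hvol` of ✓`SharpSigma.tauber_sandwich_rpow`
with `μ := ringMeasure L`, `F := swapRingDeficit L 0`), THEN the σ-glued trace obeys the fixed-`L` sharp law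
`|log Z^S(L,b,2L) − (12bL⁴ − (9L⁴−1)·log b + C)| ≤ K·b^{−θ'}` for `b ≥ β₁` (VERBATIM the per-`L` body of the skeleton's `stub_rung_fixedL`),
with `θ' = min θ ½` and `C = log v + log N! − log 4`.
Assembly: ✓`twistTrace_eq_quarter_sum_filter` (pairing `z ↦ z + (1,1,0)`: `Z^S = ¼e^{12bL⁴}Σ_{z 0 = 0} I_z`, §3) · the principal class by
✓`tauber_sandwich_rpow`, its three side conditions discharged EVENTUALLY in `b` (§1) · the other three classes with `z 0 = 0` are `O(b^{−N−1/2})`: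
`{001}` by ✓`swap_minusSector_integral_exp_le`, `{010}`, `{011}` by ✓`swap_oddSector_integral_exp_le` and `e^{−bu₀} ≤ b^{−N−1/2}` eventually (§2) ·
`0 ≤ log(1 + R/I_{000}) ≤ R/I_{000} ≤ K'·b^{−1/2}` against the floor `I_{000} ≥ v·N!·b^{−N}/e` implied by the sandwich itself (§3).
HONEST LABEL: fixed-`L` glue toward a plan-only BC5 rung of a DRAFT line; the sharp principal state-density law (the physics heart, fcl-p3 g43's
programme) is NOT proved here; ⟨24197⟩/⟨24194⟩/⟨24497⟩/⟨24196⟩ (window-uniform) stay OPEN; the Yang–Mills mass gap is NOT proved; no summit is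
proved by a line.  Width seat ym-line-sfw-p2-w2 g55 (cell ym-idea-1, free hands; own crux ⟨22884⟩ blocked-on ⟨19935⟩), `--supports stmt-QuantumFields-24197`.
THEOREMS ONLY (0 `def`, 0 `sorry`), standard axioms.  References: [cite: tHooft1979]; [cite: Luscher1983, §2]; [cite: Griffiths1964];
[cite: Vanbaal2001]; [folklore].
-/

set_option autoImplicit false

noncomputable section

open MeasureTheory Set Filter Topology
open scoped BigOperators ENNReal Nat
open Literature.MathematicalPhysics.QuantumFieldTheory hiding SU2
open Literature.MathematicalPhysics.QuantumLattice

namespace Summit.QuantumFields.YangMills.Theorems.SwapVirialDeficit.SwapRing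

open Summit.QuantumFields.YangMills.Theorems.FemtoTransferGap
open Summit.QuantumFields.YangMills.Theorems.FemtoTransferGap.TT
open Summit.QuantumFields.YangMills.Theorems.VirialFluxGap.RingDeficit
open Summit.QuantumFields.YangMills.Theorems.TwistEaterVolume.Tauber (integrable_exp_neg_mul)
open Summit.QuantumFields.YangMills.Theorems.SwapVirialDeficit.SharpSigma (tauber_sandwich_rpow)

variable {L : ℕ} [NeZero L]

/-! ## §1 The principal class: the Tauberian sandwich, eventually in `b` -/

/-- The three side conditions of ✓`tauber_sandwich_rpow` hold for all large `b` (fixed data `N, v, κ, θ, t₀`):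
`4 ≤ b`, `κ(N+2)b^{−θ} ≤ 1/4` (✓`tendsto_rpow_neg_atTop`) and `64(N+2)²(1 + |log v| + |log t₀| + log b) ≤ b·t₀` (`log b = o(b)`). [folklore] -/
theorem tauber_side_conditions_eventually (N : ℕ) {v κ θ t₀ : ℝ} (hθ : 0 < θ) (ht₀ : 0 < t₀) :
    ∀ᶠ b : ℝ in atTop, 4 ≤ b ∧ κ * ((N : ℝ) + 2) * b ^ (-θ) ≤ 1 / 4 ∧
      64 * ((N : ℝ) + 2) ^ 2 * (1 + |Real.log v| + |Real.log t₀| + Real.log b) ≤ b * t₀ := by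
  have e4 : ∀ᶠ b : ℝ in atTop, 4 ≤ b := eventually_ge_atTop 4
  have eκ : ∀ᶠ b : ℝ in atTop, κ * ((N : ℝ) + 2) * b ^ (-θ) ≤ 1 / 4 := by
    have ht : Tendsto (fun b : ℝ => κ * ((N : ℝ) + 2) * b ^ (-θ)) atTop (𝓝 0) := by
      have h := (tendsto_rpow_neg_atTop hθ).const_mul (κ * ((N : ℝ) + 2))
      rw [mul_zero] at h
      exact h
    filter_upwards [ht.eventually (Iic_mem_nhds (by norm_num : (0 : ℝ) < 1 / 4))] with b hb
    exact hb
  have ewin : ∀ᶠ b : ℝ in atTop, 64 * ((N : ℝ) + 2) ^ 2 * (1 + |Real.log v| + |Real.log t₀| + Real.log b) ≤ b * t₀ := by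
    have hlog : Tendsto (fun b : ℝ => Real.log b / b) atTop (𝓝 0) := Real.isLittleO_log_id_atTop.tendsto_div_nhds_zero
    have hconst : Tendsto (fun b : ℝ => (1 + |Real.log v| + |Real.log t₀|) / b) atTop (𝓝 0) :=
      tendsto_const_nhds.div_atTop tendsto_id
    have hsum : Tendsto (fun b : ℝ => 64 * ((N : ℝ) + 2) ^ 2 * ((1 + |Real.log v| + |Real.log t₀|) / b + Real.log b / b))
        atTop (𝓝 0) := by
      have h := (hconst.add hlog).const_mul (64 * ((N : ℝ) + 2) ^ 2)
      rw [add_zero, mul_zero] at h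
      exact h
    filter_upwards [hsum.eventually (Iic_mem_nhds ht₀), eventually_gt_atTop (0 : ℝ)] with b hb hb0
    have hb' : 64 * ((N : ℝ) + 2) ^ 2 * ((1 + |Real.log v| + |Real.log t₀|) / b + Real.log b / b) ≤ t₀ := hb
    have heq : 64 * ((N : ℝ) + 2) ^ 2 * ((1 + |Real.log v| + |Real.log t₀|) / b + Real.log b / b) =
        64 * ((N : ℝ) + 2) ^ 2 * (1 + |Real.log v| + |Real.log t₀| + Real.log b) / b := by
      field_simp
    rw [heq, div_le_iff₀ hb0] at hb'
    linarith
  filter_upwards [e4, eκ, ewin] with b h1 h2 h3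
  exact ⟨h1, h2, h3⟩

/-- ★ **The principal class, eventually**: under the sharp state-density hypothesis for `F^S_{000}`, for all large `b`
`|log ∫e^{−bF^S_{000}}dμ_L − (log v + log N! − N·log b)| ≤ 2κ(N+2)b^{−θ} + 2/b` (✓`tauber_sandwich_rpow`). [cite: Griffiths1964] -/
theorem principal_logLaplace_eventually {v κ θ t₀ : ℝ} (hv : 0 < v) (hκ : 0 ≤ κ) (hθ : 0 < θ) (hθ1 : θ ≤ 1) (ht₀ : 0 < t₀)
    (hvol : ∀ t : ℝ, 0 < t → t ≤ t₀ →
      |(ringMeasure L).real {P | swapRingDeficit L (fun _ => false) P ≤ t} / (v * t ^ (9 * L ^ 4 - 1)) - 1| ≤ κ * t ^ θ) :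
    ∀ᶠ b : ℝ in atTop,
      |Real.log (∫ P, Real.exp (-(b * swapRingDeficit L (fun _ => false) P)) ∂(ringMeasure L)) -
          (Real.log v + Real.log ((9 * L ^ 4 - 1) ! : ℝ) - ((9 * L ^ 4 - 1 : ℕ) : ℝ) * Real.log b)| ≤
        2 * κ * (((9 * L ^ 4 - 1 : ℕ) : ℝ) + 2) * b ^ (-θ) + 2 / b := by
  haveI := isProbabilityMeasure_ringMeasure (L := L)
  filter_upwards [tauber_side_conditions_eventually (9 * L ^ 4 - 1) (v := v) (κ := κ) hθ ht₀] with b hb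
  exact tauber_sandwich_rpow (ringMeasure L) (swapRingDeficit L (fun _ => false)) (9 * L ^ 4 - 1) v κ θ t₀
    (measurable_swapRingDeficit _) (swapRingDeficit_nonneg (L := L) _) hv ht₀ hκ hθ hθ1 hvol hb.1 hb.2.1 hb.2.2

/-! ## §2 The three non-principal classes with `z 0 = 0` are `O(b^{−N−1/2})` -/

/-- The members of the folded sector sum other than `z = 0` lie in the minus or odd classes. [folklore] -/
theorem minus_or_odd_of_mem_erase {z : Fin 3 → Bool}
    (hz : z ∈ ((Finset.univ : Finset (Fin 3 → Bool)).filter (fun z => z 0 = false)).erase (fun _ => false)) :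
    z 2 = true ∨ z 0 ≠ z 1 := by
  simp only [Finset.mem_erase, Finset.mem_filter, Finset.mem_univ, true_and] at hz
  obtain ⟨hne, h0⟩ := hz
  cases h2 : z 2
  · cases h1 : z 1
    · exact absurd (funext fun k => by fin_cases k <;> assumption) hne
    · right; simp [h0]
  · exact Or.inl rfl

/-- ★ **Non-principal classes, eventually**: for every `z` in a minus class (`z 2 = 1`, ✓`swap_minusSector_integral_exp_le`) or an odd class
(`z 0 ≠ z 1`, ✓`swap_oddSector_integral_exp_le` and `e^{−bu₀} ≤ b^{−N−1/2}` eventually) there is `K ≥ 0` with `∫e^{−bF^S_z}dμ_L ≤ K·b^{−(N+1/2)}` for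
all large `b`. [cite: tHooft1979] [cite: Luscher1983, §2] -/
theorem nonprincipal_laplace_eventually (z : Fin 3 → Bool) :
    ∃ K : ℝ, 0 ≤ K ∧ ∀ᶠ b : ℝ in atTop, (z 2 = true ∨ z 0 ≠ z 1) →
      ∫ P, Real.exp (-(b * swapRingDeficit L z P)) ∂(ringMeasure L) ≤ K * b ^ (-((((9 * L ^ 4 - 1 : ℕ) : ℝ)) + 1 / 2)) := by
  set N : ℕ := 9 * L ^ 4 - 1 with hN
  by_cases h2z : z 2 = true
  · obtain ⟨C, hC, u₀, hu₀, hb⟩ := swap_minusSector_integral_exp_le (L := L) z h2z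
    refine ⟨C * (N ! + (N + 1) !) / 2 + (u₀ ^ (N + 1))⁻¹ * (N + 1) !, by positivity, ?_⟩
    filter_upwards [eventually_ge_atTop (1 : ℝ)] with b hb1 _
    have hb0 : 0 < b := by linarith
    -- `1/(b^N √b) = b^{−(N+1/2)}` and `1/b^{N+1} ≤ b^{−(N+1/2)}`
    have hsqrt : Real.sqrt b = b ^ (1 / 2 : ℝ) := Real.sqrt_eq_rpow b
    have key1 : (b ^ N * Real.sqrt b)⁻¹ = b ^ (-(((N : ℕ) : ℝ) + 1 / 2)) := by
      rw [hsqrt, ← Real.rpow_natCast b N, ← Real.rpow_add hb0, Real.rpow_neg hb0.le]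
    have key2 : (b ^ (N + 1))⁻¹ ≤ b ^ (-(((N : ℕ) : ℝ) + 1 / 2)) := by
      rw [← Real.rpow_natCast b (N + 1), ← Real.rpow_neg hb0.le]
      refine Real.rpow_le_rpow_of_exponent_le hb1 ?_
      push_cast
      linarith
    have hK1 : 0 ≤ C * (N ! + (N + 1) !) / 2 := by positivity
    have hK2 : 0 ≤ (u₀ ^ (N + 1))⁻¹ * ((N + 1) ! : ℝ) := by positivity
    calc ∫ P, Real.exp (-(b * swapRingDeficit L z P)) ∂(ringMeasure L)
        ≤ C * (N ! + (N + 1) !) / (2 * b ^ N * Real.sqrt b) + (u₀ ^ (N + 1))⁻¹ * (N + 1) ! / b ^ (N + 1) := hb b hb0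
      _ = C * (N ! + (N + 1) !) / 2 * (b ^ N * Real.sqrt b)⁻¹ + (u₀ ^ (N + 1))⁻¹ * (N + 1) ! * (b ^ (N + 1))⁻¹ := by
          field_simp
      _ ≤ C * (N ! + (N + 1) !) / 2 * b ^ (-(((N : ℕ) : ℝ) + 1 / 2)) +
            (u₀ ^ (N + 1))⁻¹ * (N + 1) ! * b ^ (-(((N : ℕ) : ℝ) + 1 / 2)) := by
          rw [key1]
          exact add_le_add le_rfl (mul_le_mul_of_nonneg_left key2 hK2)
      _ = (C * (N ! + (N + 1) !) / 2 + (u₀ ^ (N + 1))⁻¹ * (N + 1) !) * b ^ (-(((N : ℕ) : ℝ) + 1 / 2)) := by ring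
  · by_cases h01 : z 0 ≠ z 1
    · obtain ⟨u₀, hu₀, hb⟩ := swap_oddSector_integral_exp_le (L := L) z h01
      refine ⟨1, zero_le_one, ?_⟩
      have ht : Tendsto (fun b : ℝ => b ^ (((N : ℕ) : ℝ) + 1 / 2) * Real.exp (-u₀ * b)) atTop (𝓝 0) :=
        tendsto_rpow_mul_exp_neg_mul_atTop_nhds_zero _ _ hu₀
      filter_upwards [ht.eventually (Iic_mem_nhds one_pos), eventually_gt_atTop (0 : ℝ)] with b hb1 hb0 _
      have hb1' : b ^ (((N : ℕ) : ℝ) + 1 / 2) * Real.exp (-u₀ * b) ≤ 1 := hb1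
      have hpow : 0 < b ^ (((N : ℕ) : ℝ) + 1 / 2) := Real.rpow_pos_of_pos hb0 _
      have hneg : b ^ (-(((N : ℕ) : ℝ) + 1 / 2)) = (b ^ (((N : ℕ) : ℝ) + 1 / 2))⁻¹ := Real.rpow_neg hb0.le _
      calc ∫ P, Real.exp (-(b * swapRingDeficit L z P)) ∂(ringMeasure L) ≤ Real.exp (-(b * u₀)) := hb b hb0.le
        _ = (b ^ (((N : ℕ) : ℝ) + 1 / 2))⁻¹ * (b ^ (((N : ℕ) : ℝ) + 1 / 2) * Real.exp (-u₀ * b)) := by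
            rw [← mul_assoc, inv_mul_cancel₀ hpow.ne', one_mul, show -(b * u₀) = -u₀ * b by ring]
        _ ≤ (b ^ (((N : ℕ) : ℝ) + 1 / 2))⁻¹ * 1 := mul_le_mul_of_nonneg_left hb1' (inv_nonneg.2 hpow.le)
        _ = 1 * b ^ (-(((N : ℕ) : ℝ) + 1 / 2)) := by rw [hneg]; ring
    · exact ⟨0, le_rfl, Eventually.of_forall fun b hcond => (hcond.elim h2z h01).elim⟩

/-! ## §3 The rung modulo the principal sharp law -/
set_option maxHeartbeats 400000 in
/-- ★★★ **THE SHARP-σ RUNG AT FIXED `L`, MODULO THE PRINCIPAL SECTOR LAW.**  If the σ-glued principal-sector deficit `F^S_{000}` has the sharp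
state density `|μ_L{F^S_{000} ≤ t}/(v·t^{9L⁴−1}) − 1| ≤ κ·t^θ` on `(0, t₀]` (the hypothesis of ✓`tauber_sandwich_rpow`, verbatim), then
`|log Z^S(L,b,2L) − (12bL⁴ − (9L⁴−1)·log b + C)| ≤ K·b^{−θ'}` for all `b ≥ β₁` — the per-`L` body of `stub_rung_fixedL` of LINE «sharp-sigma» —
with `θ' = min θ ½`, `C = log v + log (9L⁴−1)! − log 4`: pairing (✓`twistTrace_eq_quarter_sum_filter`), triage (§2) and the principal sandwich (§1).
[cite: tHooft1979] [cite: Luscher1983, §2] [cite: Griffiths1964] [cite: Vanbaal2001] -/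
theorem swap_rung_fixedL_of_principalLaw (L : ℕ) [NeZero L] {v κ θ t₀ : ℝ} (hv : 0 < v) (hκ : 0 ≤ κ) (hθ : 0 < θ)
    (hθ1 : θ ≤ 1) (ht₀ : 0 < t₀)
    (hvol : ∀ t : ℝ, 0 < t → t ≤ t₀ →
      |(ringMeasure L).real {P | swapRingDeficit L (fun _ => false) P ≤ t} / (v * t ^ (9 * L ^ 4 - 1)) - 1| ≤ κ * t ^ θ) :
    ∃ C K θ' β₁ : ℝ, 0 < θ' ∧ ∀ b : ℝ, β₁ ≤ b →
      |Real.log (TT.twistTrace L b (2 * L)) - (12 * b * (L : ℝ) ^ 4 - (9 * (L : ℝ) ^ 4 - 1) * Real.log b + C)| ≤ K * b ^ (-θ') := by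
  haveI := isProbabilityMeasure_ringMeasure (L := L)
  set N : ℕ := 9 * L ^ 4 - 1 with hN
  have hL1 : 1 ≤ L := NeZero.one_le
  have h9 : 1 ≤ 9 * L ^ 4 := by have := Nat.one_le_pow 4 L hL1; omega
  have hNcast : ((N : ℕ) : ℝ) = 9 * (L : ℝ) ^ 4 - 1 := by
    rw [hN, Nat.cast_sub h9]; push_cast; ring
  -- the sector Laplace integrals
  set I : (Fin 3 → Bool) → ℝ → ℝ := fun z b => ∫ P, Real.exp (-(b * swapRingDeficit L z P)) ∂(ringMeasure L) with hI
  have hI0 : ∀ z b, 0 ≤ I z b := fun z b => integral_nonneg fun P => (Real.exp_pos _).le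
  -- §2: the non-principal classes
  have h2 := fun z : Fin 3 → Bool => nonprincipal_laplace_eventually (L := L) z
  choose K hK0 hK using h2
  have h2' : ∀ᶠ b : ℝ in atTop, ∀ z : Fin 3 → Bool, (z 2 = true ∨ z 0 ≠ z 1) → I z b ≤ K z * b ^ (-(((N : ℕ) : ℝ) + 1 / 2)) :=
    eventually_all.2 fun z => hK z
  -- the folded sector set and its remainder constant
  set S : Finset (Fin 3 → Bool) := (Finset.univ : Finset (Fin 3 → Bool)).filter (fun z => z 0 = false) with hS
  have hz₀ : (fun _ : Fin 3 => false) ∈ S := by simp [hS]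
  set Ktot : ℝ := ∑ z ∈ S.erase (fun _ => false), K z with hKtot
  have hKtot0 : 0 ≤ Ktot := Finset.sum_nonneg fun z _ => hK0 z
  -- the constants of the rung
  set M₀ : ℝ := Real.log v + Real.log (N ! : ℝ) with hM₀
  obtain ⟨β₁, hβ₁⟩ := (((principal_logLaplace_eventually (L := L) hv hκ hθ hθ1 ht₀ hvol).and h2').and
    ((tauber_side_conditions_eventually N (v := v) (κ := κ) hθ ht₀).and (eventually_ge_atTop (4 : ℝ)))).exists_forall_of_atTop
  refine ⟨M₀ - Real.log 4, 2 * κ * (((N : ℕ) : ℝ) + 2) + 2 + Ktot * Real.exp (1 - M₀), min θ (1 / 2), β₁, lt_min hθ (by norm_num),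
    fun b hb => ?_⟩
  obtain ⟨⟨hP, hR⟩, ⟨hside, hb4⟩⟩ := hβ₁ b hb
  have hb1 : 1 ≤ b := by linarith
  have hb0 : 0 < b := by linarith
  -- the principal integral and its floor
  have hIpos : 0 < I (fun _ => false) b :=
    integral_exp_pos (integrable_exp_neg_mul (μ := ringMeasure L) _ (measurable_swapRingDeficit _) (swapRingDeficit_nonneg (L := L) _) hb0)
  set E : ℝ := 2 * κ * (((N : ℕ) : ℝ) + 2) * b ^ (-θ) + 2 / b with hE
  have hP' : |Real.log (I (fun _ => false) b) - (M₀ - ((N : ℕ) : ℝ) * Real.log b)| ≤ E := by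
    rw [hM₀]; exact hP
  have hE1 : E ≤ 1 := by
    have : 2 / b ≤ 1 / 2 := by rw [div_le_iff₀ hb0]; linarith
    have : 2 * κ * (((N : ℕ) : ℝ) + 2) * b ^ (-θ) ≤ 1 / 2 := by linarith [hside.2.1]
    linarith
  have hfloor : Real.exp (M₀ - ((N : ℕ) : ℝ) * Real.log b - 1) ≤ I (fun _ => false) b := by
    have h := (abs_le.1 hP').1
    calc Real.exp (M₀ - ((N : ℕ) : ℝ) * Real.log b - 1) ≤ Real.exp (Real.log (I (fun _ => false) b)) :=
          Real.exp_le_exp.2 (by linarith)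
      _ = I (fun _ => false) b := Real.exp_log hIpos
  -- the remainder
  set R : ℝ := ∑ z ∈ S.erase (fun _ => false), I z b with hRdef
  have hR0 : 0 ≤ R := Finset.sum_nonneg fun z _ => hI0 z b
  have hRle : R ≤ Ktot * b ^ (-(((N : ℕ) : ℝ) + 1 / 2)) := by
    rw [hRdef, hKtot, Finset.sum_mul]
    exact Finset.sum_le_sum fun z hz => hR z (minus_or_odd_of_mem_erase hz)
  -- the folded sum and its logarithm
  have hsum : ∑ z ∈ S, I z b = I (fun _ => false) b + R := (Finset.add_sum_erase S (fun z => I z b) hz₀).symm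
  have hZ : TT.twistTrace L b (2 * L) = (1 / 4 : ℝ) * Real.exp (12 * b * (L : ℝ) ^ 4) * (I (fun _ => false) b + R) := by
    rw [← hsum, twistTrace_eq_quarter_sum_filter, ← Finset.mul_sum]
    simp only [hI, hS]
    ring
  have hSpos : 0 < I (fun _ => false) b + R := by linarith
  -- `log(I₀ + R) = log I₀ + log(1 + R/I₀)` with `0 ≤ log(1 + R/I₀) ≤ R/I₀ ≤ Ktot·e^{1−M₀}·b^{−1/2}`
  have hx0 : 0 ≤ R / I (fun _ => false) b := div_nonneg hR0 hIpos.le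
  have hx1 : (1 : ℝ) ≤ 1 + R / I (fun _ => false) b := le_add_of_nonneg_right hx0
  have hxpos : (0 : ℝ) < 1 + R / I (fun _ => false) b := add_pos_of_pos_of_nonneg one_pos hx0
  have hlog1 : 0 ≤ Real.log (1 + R / I (fun _ => false) b) ∧ Real.log (1 + R / I (fun _ => false) b) ≤ R / I (fun _ => false) b := by
    refine ⟨Real.log_nonneg hx1, ?_⟩
    have h := Real.log_le_sub_one_of_pos hxpos
    rwa [add_sub_cancel_left] at h
  have h1ne : (1 + R / I (fun _ => false) b) ≠ 0 := hxpos.ne'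
  have hmul : I (fun _ => false) b + R = I (fun _ => false) b * (1 + R / I (fun _ => false) b) := by
    rw [mul_add, mul_one, mul_div_cancel₀ _ hIpos.ne']
  have hsplit : Real.log (I (fun _ => false) b + R) = Real.log (I (fun _ => false) b) + Real.log (1 + R / I (fun _ => false) b) := by
    rw [hmul, Real.log_mul hIpos.ne' h1ne]
  have hexp : b ^ (-(((N : ℕ) : ℝ) + 1 / 2)) / Real.exp (M₀ - ((N : ℕ) : ℝ) * Real.log b - 1) =
      Real.exp (1 - M₀) * b ^ (-(1 / 2 : ℝ)) := by
    rw [Real.rpow_def_of_pos hb0, Real.rpow_def_of_pos hb0, ← Real.exp_sub, ← Real.exp_add, Real.exp_eq_exp]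
    ring
  have hratio : R / I (fun _ => false) b ≤ Ktot * Real.exp (1 - M₀) * b ^ (-(1 / 2 : ℝ)) := by
    have hden : 0 < Real.exp (M₀ - ((N : ℕ) : ℝ) * Real.log b - 1) := Real.exp_pos _
    have hnum : 0 ≤ Ktot * b ^ (-(((N : ℕ) : ℝ) + 1 / 2)) := mul_nonneg hKtot0 (Real.rpow_nonneg hb0.le _)
    calc R / I (fun _ => false) b ≤ Ktot * b ^ (-(((N : ℕ) : ℝ) + 1 / 2)) / Real.exp (M₀ - ((N : ℕ) : ℝ) * Real.log b - 1) :=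
          div_le_div₀ hnum hRle hden hfloor
      _ = Ktot * (b ^ (-(((N : ℕ) : ℝ) + 1 / 2)) / Real.exp (M₀ - ((N : ℕ) : ℝ) * Real.log b - 1)) := mul_div_assoc _ _ _
      _ = Ktot * Real.exp (1 - M₀) * b ^ (-(1 / 2 : ℝ)) := by rw [hexp, mul_assoc]
  -- exponents: `b^{−θ}, b^{−1}, b^{−1/2} ≤ b^{−θ'}`
  have hθ' : b ^ (-θ) ≤ b ^ (-min θ (1 / 2)) := Real.rpow_le_rpow_of_exponent_le hb1 (neg_le_neg (min_le_left _ _))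
  have hhalf : b ^ (-(1 / 2 : ℝ)) ≤ b ^ (-min θ (1 / 2)) := Real.rpow_le_rpow_of_exponent_le hb1 (neg_le_neg (min_le_right _ _))
  have hone : 2 / b ≤ 2 * b ^ (-min θ (1 / 2)) := by
    have h1 : b⁻¹ = b ^ (-(1 : ℝ)) := (Real.rpow_neg_one b).symm
    have h2 : b ^ (-(1 : ℝ)) ≤ b ^ (-min θ (1 / 2)) :=
      Real.rpow_le_rpow_of_exponent_le hb1 (neg_le_neg ((min_le_right _ _).trans (by norm_num)))
    rw [div_eq_mul_inv, h1]; linarith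
  have hpow0 : 0 ≤ b ^ (-min θ (1 / 2)) := Real.rpow_nonneg hb0.le _
  -- assemble
  have hlogZ : Real.log (TT.twistTrace L b (2 * L)) =
      -Real.log 4 + 12 * b * (L : ℝ) ^ 4 + (Real.log (I (fun _ => false) b) + Real.log (1 + R / I (fun _ => false) b)) := by
    rw [hZ, Real.log_mul (by positivity) hSpos.ne', Real.log_mul (by norm_num) (Real.exp_pos _).ne', Real.log_exp, hsplit,
      one_div, Real.log_inv]
  rw [hlogZ, ← hNcast]
  have hdev : -Real.log 4 + 12 * b * (L : ℝ) ^ 4 + (Real.log (I (fun _ => false) b) + Real.log (1 + R / I (fun _ => false) b)) -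
      (12 * b * (L : ℝ) ^ 4 - ((N : ℕ) : ℝ) * Real.log b + (M₀ - Real.log 4)) =
      (Real.log (I (fun _ => false) b) - (M₀ - ((N : ℕ) : ℝ) * Real.log b)) + Real.log (1 + R / I (fun _ => false) b) := by ring
  rw [hdev]
  calc |Real.log (I (fun _ => false) b) - (M₀ - ((N : ℕ) : ℝ) * Real.log b) + Real.log (1 + R / I (fun _ => false) b)|
      ≤ |Real.log (I (fun _ => false) b) - (M₀ - ((N : ℕ) : ℝ) * Real.log b)| + |Real.log (1 + R / I (fun _ => false) b)| :=
        abs_add_le _ _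
    _ ≤ E + Ktot * Real.exp (1 - M₀) * b ^ (-(1 / 2 : ℝ)) := by
        rw [abs_of_nonneg hlog1.1]
        exact add_le_add hP' (hlog1.2.trans hratio)
    _ ≤ (2 * κ * (((N : ℕ) : ℝ) + 2) + 2 + Ktot * Real.exp (1 - M₀)) * b ^ (-min θ (1 / 2)) := by
        rw [hE]
        have hA : 2 * κ * (((N : ℕ) : ℝ) + 2) * b ^ (-θ) ≤ 2 * κ * (((N : ℕ) : ℝ) + 2) * b ^ (-min θ (1 / 2)) :=
          mul_le_mul_of_nonneg_left hθ' (by positivity)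
        have hB : Ktot * Real.exp (1 - M₀) * b ^ (-(1 / 2 : ℝ)) ≤ Ktot * Real.exp (1 - M₀) * b ^ (-min θ (1 / 2)) :=
          mul_le_mul_of_nonneg_left hhalf (by positivity)
        nlinarith [hA, hB, hone, hpow0]

end Summit.QuantumFields.YangMills.Theorems.SwapVirialDeficit.SwapRing

end
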